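import Literature.MathematicalPhysics.QuantumFieldTheory.Balaban1983to89.B6Ineq2134KLevelTorus
import Literature.MathematicalPhysics.QuantumFieldTheory.Balaban1983to89.B6Ineq2134DiagKLevel

/-!
# `Balaban1983to89.B6Ineq2134DiagKLevelTorus` — T. Bałaban, *Propagators and renormalization transformations for lattice gauge theories. II*,
# Commun. Math. Phys. **96** (1984) 223–250 [Balaban1984PropagatorsII], Prop. 2.6 p. 247 with (2.92) p. 239: (2.134) FOR THE DIAGONAL PAIRS `K_{□,□}`
# ON THE GENUINE MULTI-LEVEL TORUS — the torus twin of `…B6Ineq2134DiagKLevel` (file 2 of the torus port): r03's `diag_hasMajorant` on B8's census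
# geometry `geomTB D` of a genuine nested family `D : TDomains` on the torus, (2.60)/(2.63)/`L² ≤ e^{⅛δRM}` discharged by file 1 of the port, for ANY
# fine lattice `X`/block map/`∂P∂*`-candidate `Dg`; `θ_diag = Θ·U/M` with `…B6Ineq2134DiagKLevel.theta_pack_le` BY NAME

statement-level skeleton of published theorems with citation tags; proofs where landed; nothing here is a claim about the Yang–Mills mass gap

PDF held: `paper:balaban1984-cmp96-propagators-rt-ii` (journal page = PDF page + 222): p. 239 [PDF 17] ((2.90)–(2.92)), p. 247 [PDF 25] ((2.134)); read from the
tree transcriptions (`…B6Ineq2134Diag`, `…B6Eq291Generator`).  PRINT p. 247: *"It is easy to see that the same considerations can be applied to K_{□,□}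
using the explicit representation (2.92) (e.g., h_□′(x′) − h_□′(x) can be estimated by O(1)M^{−1}d(y,y′))"*.

CITATION HEADER (lean-in-tree rule) — WHAT IS REPRODUCED.  Phase-2 file of the `lit-balaban` typed skeleton (HOME `run/shared/lean/pub/lit-balaban/`), seat
**p38 gen 25**; B6-CLOSURE §5 item 9 (torus port of the (2.134) inputs for ROUTE V), file 2; SKELETON rows **B6.Eq2.134** × **B6.Eq2.91** ((2.92)) ×
**B6.Prop2.6** (cells only; decls of record untouched; referee ref-4).  The statements and proofs are those of `…B6Ineq2134DiagKLevel` (p342758, box members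
`i : KIdx`) with the member replaced by a genuine nested family `D : TDomains d ℓ M_h k P R` ON THE TORUS (`M_h ≥ 1`, `P_μ ≥ 1`, `R ≥ 2L`, threshold
`L·M_h ≥ M₀`) and the geometry by B8's `geomTB D` (`M = L·M_h`, `R·M = R·L·M_h − 1`, `len y = L^j` in lattice units; sites/`dist`/`len` ≡ `geomT D`):
* §1 **`ineq2134_diag_torus`**: `HasMajorant blk ((line 1 + (line 2 + line 4) + line 3)·G_□·h_□) (θ_diag·e^{−½δd})` with r03's explicit `θ_diag`, for every
  fine lattice `X`, block map `blk : X → 𝔅`, and all displayed data (as in the box file), above ONE threshold;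
* §2 **`ineq2134_kDiag_torus`**: the same for `K_{□,□} = …B6Eq291Generator.kDiag Dg h_□ ζ_□ M_□ P_□` BY NAME under the displayed decomposition `hdec`;
* §3 **`ineq2134_kDiag_torus_theta`**: `θ_diag ≤ Θ·U/M`, `U = #E·s₁C₁ + s₂C_G + (#K+1)·s·((C_N+1)C_G(1+r₀)) + C_DC_G/c_D` (`theta_pack_le` by name) — literally
  the hypothesis `h2134` of `…B6Prop26Gluing.majorant_R_of_2134` / r03's `B6GlobalChartV1.prop26_2136_V1_of_2134_eq291` for the pair (□, □), ON THE TORUS.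
No `def`, no new fact; standard axioms.
HONEST SCOPE. As the box file: abstract in the per-cube data (line-1 decomposition, `P_□`, the change of domain `D₃` — displayed hypotheses); lengths in
lattice units (`η = 1`); constants `L`-dependent, `k`/`M_h`-independent; integer torus; nothing on d = 4 or the continuum; NOT summit progress.
Unit `lit-balaban-p38` (gen 25), 2026-08-23.
-/

namespace Literature.MathematicalPhysics.QuantumFieldTheory.Balaban1983to89.B6Ineq2134DiagKLevelTorus

open Literature.MathematicalPhysics.QuantumFieldTheory.Balaban1983to89.B6MultiLevelTorusOperator (TDomains)
open Literature.MathematicalPhysics.QuantumFieldTheory.Balaban1983to89.B8Ineq192MultiLevelTorus (geomTB geomTB_L geomTB_M levelSepTB)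
open Literature.MathematicalPhysics.QuantumFieldTheory.Balaban1983to89.B6Ineq261LevelGap (K261 K261_nonneg)
open Literature.MathematicalPhysics.QuantumFieldTheory.Balaban1983to89.B6RandomWalk (HasMajorant hasMajorant_mono)
open Literature.MathematicalPhysics.QuantumFieldTheory.Balaban1983to89.B6Prop26Gluing (mulOp mulOp_apply LocalMajorant OutLoc)
open Literature.MathematicalPhysics.QuantumFieldTheory.Balaban1983to89.B6Ineq268 (LevelSep)
open Literature.MathematicalPhysics.QuantumFieldTheory.Balaban1983to89.B6Lemma21Repaired (Ineq263With)
open Literature.MathematicalPhysics.QuantumFieldTheory.Balaban1983to89.B6Ineq2134Diag (diag_hasMajorant)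
open Literature.MathematicalPhysics.QuantumFieldTheory.Balaban1983to89.B6Ineq2134KLevelTorus
  (one_le_L_TB eta_pos_TB M_pos_TB one_le_RLMh RM_nonneg_TB dist_nonneg_TB ineq263_geomTB thr_geomTB)
open Literature.MathematicalPhysics.QuantumFieldTheory.Balaban1983to89.B6Ineq2134DiagKLevel (theta_pack_le)
open Literature.MathematicalPhysics.QuantumFieldTheory.Balaban1983to89.B6Eq291Generator (kDiag)

variable {d ℓ : ℕ}

/-- `a ≤ (a + 1)(b + 1)` for `a, b ≥ 0`. [folklore] -/
private theorem le_mul_succ_left {a b : ℝ} (ha : 0 ≤ a) (hb : 0 ≤ b) : a ≤ (a + 1) * (b + 1) := by nlinarith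

/-! ## §1  (2.134) for □ = □′ on the torus: (2.60), (2.63), the largeness discharged -/

/-- **(2.134) FOR THE DIAGONAL PAIRS □ = □′ ON THE GENUINE MULTI-LEVEL TORUS** — r03's `diag_hasMajorant` with (2.60) B8's `levelSepTB`, (2.63) at `(¾δ, ⅓)`
`ineq263_geomTB` (constant `c = K261 N₀ (d+1) L 1 (¼δ)`) and the largeness `L² ≤ e^{⅛δRM}` `thr_geomTB` DISCHARGED (file 1 of the port): for every rate `δ > 0` there are ONE threshold
`M₀` and ONE constant `c ≥ 0` (on `d, L, δ`) such that for every member with `L·M_h ≥ M₀` and all displayed data — `G_□` (transported to the vector fields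
`X`, output-localised to the reach `S`, with the (2.133)-shape local majorants `C_G(L^jη)²e^{−δd}` and, for the first-order pieces `E_i∘G_□`,
`C₁(L^jη)e^{−δd}`), line 1 of (2.92) `Σ_i c_iE_i − c₀` (`|c_i| ≤ s₁/(M·L^jη)`, `|c₀| ≤ s₂/(M·(L^jη)²)`, supported over `S`), `h_□` (`|h_□| ≤ 1` over `S`,
block-Lipschitz `(s/M)(d + r₀)`), the line-2 partners `N_k` and the line-4 partner `Pl` (= `∂P_□∂*`) with (2.88)-shape majorants `C_N(L^jη)^{−2}e^{−δd}`,
cut-offs `|z_k|, |ζ_□| ≤ 1`, and line 3 `D₃` with the change-of-domain majorant `C_De^{−c_DM}(L^jη)^{−2}e^{−δd}` —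
`HasMajorant blk ((line 1 + (Σ_k z_k[N_k, h_□]-terms + ζ_□(Pl h_□ − h_□ Pl)) + D₃)·G_□·h_□) (θ_diag·e^{−½δ d})`,
`θ_diag = (#E·s₁C₁ + s₂C_G)/M + (#K+1)·(s/M)·C_NC_GL²(8/δ + r₀)c² + C_De^{−c_DM}C_GL²c²` — r03's explicit `O(M⁻¹)` (`theta_diag_le`).
[cite: Balaban1984PropagatorsII, (2.134) p.247; (2.92) p.239; Lemma 2.1 (2.60), (2.63) p.234; (2.68) p.235 (remarks)] -/
theorem ineq2134_diag_torus (d ℓ : ℕ) {δ : ℝ} (hδ : 0 < δ) :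
    ∃ M₀ c : ℝ, 0 < M₀ ∧ 0 ≤ c ∧
      ∀ {Mh k R : ℕ} {P : Fin (d + 1) → ℕ} (D : TDomains d ℓ Mh k P R), 1 ≤ Mh → (∀ μ, 1 ≤ P μ) → 2 * (ℓ + 1) ≤ R →
        M₀ ≤ ((ℓ : ℝ) + 1) * Mh → ∀ {X : Type} (blk : X → (geomTB D).Site),
        ∀ {CG C₁ CN CD cD s s₁ s₂ r₀ : ℝ}, 0 ≤ CG → 0 ≤ C₁ → 0 ≤ CN → 0 ≤ CD → 0 ≤ s → 0 ≤ s₁ → 0 ≤ s₂ → 0 ≤ r₀ →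
        ∀ {Gl Pl D₃ : Module.End ℝ (X → ℝ)} {hI c₀ ζ : X → ℝ} {S : Set (geomTB D).Site}
          {ι : Type} (DE : Finset ι) {E : ι → Module.End ℝ (X → ℝ)} {cf : ι → X → ℝ}
          {κ : Type} (DK : Finset κ) {N : κ → Module.End ℝ (X → ℝ)} {z : κ → X → ℝ},
          LocalMajorant blk Gl S (fun y y' => CG * (geomTB D).len y ^ 2 * Real.exp (-(δ * (geomTB D).dist y y'))) →
          OutLoc blk Gl S →
          (∀ e ∈ DE, LocalMajorant blk (E e * Gl) S (fun y y' => C₁ * (geomTB D).len y * Real.exp (-(δ * (geomTB D).dist y y')))) →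
          (∀ e ∈ DE, ∀ x, |cf e x| ≤ s₁ / ((geomTB D).M * (geomTB D).len (blk x))) → (∀ e ∈ DE, ∀ x, cf e x ≠ 0 → blk x ∈ S) →
          (∀ x, |c₀ x| ≤ s₂ / ((geomTB D).M * (geomTB D).len (blk x) ^ 2)) → (∀ x, c₀ x ≠ 0 → blk x ∈ S) →
          (∀ x, |hI x| ≤ 1) → (∀ x, hI x ≠ 0 → blk x ∈ S) →
          (∀ x x', |hI x' - hI x| ≤ s / (geomTB D).M * ((geomTB D).dist (blk x) (blk x') + r₀)) →
          (∀ k ∈ DK, HasMajorant blk (N k) (fun y y'' => CN / (geomTB D).len y ^ 2 * Real.exp (-(δ * (geomTB D).dist y y'')))) →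
          (∀ k ∈ DK, ∀ x, |z k x| ≤ 1) →
          HasMajorant blk Pl (fun y y'' => CN / (geomTB D).len y ^ 2 * Real.exp (-(δ * (geomTB D).dist y y''))) →
          (∀ x, |ζ x| ≤ 1) →
          HasMajorant blk D₃ (fun y y'' => CD * Real.exp (-(cD * (geomTB D).M)) / (geomTB D).len y ^ 2 * Real.exp (-(δ * (geomTB D).dist y y''))) →
          HasMajorant blk
            ((((∑ e ∈ DE, mulOp (cf e) * E e - mulOp c₀) +
                ((∑ k ∈ DK, mulOp (z k) * (N k * mulOp hI - mulOp hI * N k)) + mulOp ζ * (Pl * mulOp hI - mulOp hI * Pl))) + D₃) *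
              Gl * mulOp hI)
            (fun y y' =>
              ((DE.card * (s₁ * C₁) + s₂ * CG) / (geomTB D).M +
                    (DK.card + 1) * (s / (geomTB D).M * (CN * CG * (geomTB D).L ^ 2 * (8 / δ + r₀)) * c ^ 2) +
                  CD * Real.exp (-(cD * (geomTB D).M)) * CG * (geomTB D).L ^ 2 * c ^ 2) *
                Real.exp (-(1 / 2 * δ * (geomTB D).dist y y'))) := by
  classical
  -- (2.63) at `(¾δ, ⅓)`, the largeness threshold, the constant
  obtain ⟨N₀, hN₀pos, h263⟩ := ineq263_geomTB d ℓ hδ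
  obtain ⟨N₂, hthr⟩ := thr_geomTB d ℓ hδ
  obtain ⟨c, hc⟩ : ∃ c : ℝ, c = K261 N₀ (d + 1) ((ℓ : ℝ) + 1) 1 (1 / 3 * (3 / 4 * δ)) := ⟨_, rfl⟩
  have hcnn : 0 ≤ c := by rw [hc]; exact K261_nonneg (by positivity) zero_le_one
  obtain ⟨M₀, hM₀⟩ : ∃ M₀ : ℝ, M₀ = max ((N₀ : ℝ) + 1) ((N₂ : ℝ) + 1) := ⟨_, rfl⟩
  refine ⟨M₀, c, by rw [hM₀]; exact lt_max_of_lt_left (by positivity), hcnn, ?_⟩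
  intro Mh k R P D hMh hP hR hM X blk CG C₁ CN CD cD s s₁ s₂ r₀ hCG hC₁ hCN hCD hs hs₁ hs₂ hr₀ Gl Pl D₃ hI c₀ ζ S ι DE E cf κ DK N z hG hGout hEG hcf hcfS
    hc₀ hc₀S hI1 hIS hLip hN hz hPl hζ hD
  -- the member's thresholds and side facts
  have hMN₀ : (N₀ : ℝ) + 1 ≤ ((ℓ : ℝ) + 1) * Mh := (le_max_left _ _).trans (hM₀ ▸ hM)
  have hMN₂ : (N₂ : ℝ) + 1 ≤ ((ℓ : ℝ) + 1) * Mh := (le_max_right _ _).trans (hM₀ ▸ hM)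
  have hL1 := one_le_L_TB D
  have hη := eta_pos_TB D
  have hMpos := M_pos_TB D hMh
  have hRM := RM_nonneg_TB D hMh hR
  have h263i : Ineq263With c (geomTB D) (3 / 4 * δ) (1 / 3) := by rw [hc]; exact h263 D hMh hP hR hMN₀
  -- lines 2 and 4 as ONE commutator family indexed by `Option κ` (`none` = the line-4 partner `∂P_□∂*`)
  have hN'maj : ∀ o ∈ Finset.insertNone DK, HasMajorant blk ((fun o : Option κ => o.elim Pl N) o)
      (fun y y'' => CN / (geomTB D).len y ^ 2 * Real.exp (-(δ * (geomTB D).dist y y''))) := by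
    intro o ho
    cases o with
    | none => exact hPl
    | some k => exact hN k (Finset.some_mem_insertNone.1 ho)
  have hz'le : ∀ o ∈ Finset.insertNone DK, ∀ x, |(fun o : Option κ => o.elim ζ z) o x| ≤ 1 := by
    intro o ho x
    cases o with
    | none => exact hζ x
    | some k => exact hz k (Finset.some_mem_insertNone.1 ho) x
  have hsum : (∑ k ∈ DK, mulOp (z k) * (N k * mulOp hI - mulOp hI * N k)) + mulOp ζ * (Pl * mulOp hI - mulOp hI * Pl) =
      ∑ o ∈ Finset.insertNone DK,
        mulOp ((fun o : Option κ => o.elim ζ z) o) *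
          ((fun o : Option κ => o.elim Pl N) o * mulOp hI - mulOp hI * (fun o : Option κ => o.elim Pl N) o) := by
    rw [Finset.sum_insertNone]
    exact add_comm _ _
  have key := diag_hasMajorant blk hL1 hη (levelSepTB D hMh hP (one_le_RLMh hMh hR)) (dist_nonneg_TB D hMh hP) hδ hCG hC₁ hCN hCD hs hs₁ hs₂ hr₀
    hMpos hRM (hthr D hMh hR hMN₂) h263i DE (Finset.insertNone DK) (N := fun o : Option κ => o.elim Pl N) (z := fun o : Option κ => o.elim ζ z)
    hG hGout hEG hcf hcfS hc₀ hc₀S hI1 hIS hLip hN'maj hz'le hD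
  rw [hsum, mul_assoc]
  refine hasMajorant_mono _ key fun y y' => le_of_eq ?_
  rw [Finset.card_insertNone]
  push_cast
  ring

/-! ## §2  The same for `K_{□,□} = kDiag (∂P∂*) h_□ ζ_□ M_□ P_□` of (2.92) BY NAME, on the torus -/

/-- **(2.134) FOR `K_{□,□}G_□h_□` WITH `K_{□,□} = …B6Eq291Generator.kDiag (∂P∂*) h_□ ζ_□ M_□ P_□` BY NAME** (`kDiag Dg h z m p = (hm − mh) + z(Dg − p)h +
z(ph − hp)`: lines 1–2 = the commutator of `h_□` with the `T_□`-version `M_□` of `Δ + Q*aQ`, line 3 = the change of domain `ζ_□(∂P∂* − ∂P_□∂*)h_□`, line 4 =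
`ζ_□[∂P_□∂*, h_□] = ζ_□P_{□,1}(∂h_□)`), any `∂P∂* =: Dg`: under the displayed decomposition `hdec` of the commutator into line 1
(first-order form) + line 2 (kernel commutators), the (2.88)-shape majorant of `P_□ =: Pl`, the change-of-domain majorant of `ζ_□(∂P∂* − P_□)h_□` and the data of
`ineq2134_diag_torus` — for every member above ONE threshold: `HasMajorant blk ((K_{□,□}·G_□)·h_□) (θ_diag·e^{−½δ d})` with r03's explicit `θ_diag`.
[cite: Balaban1984PropagatorsII, (2.134) p.247; (2.92) p.239] -/
theorem ineq2134_kDiag_torus (d ℓ : ℕ) {δ : ℝ} (hδ : 0 < δ) :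
    ∃ M₀ c : ℝ, 0 < M₀ ∧ 0 ≤ c ∧
      ∀ {Mh k R : ℕ} {P : Fin (d + 1) → ℕ} (D : TDomains d ℓ Mh k P R), 1 ≤ Mh → (∀ μ, 1 ≤ P μ) → 2 * (ℓ + 1) ≤ R →
        M₀ ≤ ((ℓ : ℝ) + 1) * Mh → ∀ {X : Type} (blk : X → (geomTB D).Site) (Dg : Module.End ℝ (X → ℝ)),
        ∀ {CG C₁ CN CD cD s s₁ s₂ r₀ : ℝ}, 0 ≤ CG → 0 ≤ C₁ → 0 ≤ CN → 0 ≤ CD → 0 ≤ s → 0 ≤ s₁ → 0 ≤ s₂ → 0 ≤ r₀ →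
        ∀ {Gl Ml Pl : Module.End ℝ (X → ℝ)} {hI c₀ ζ : X → ℝ} {S : Set (geomTB D).Site}
          {ι : Type} (DE : Finset ι) {E : ι → Module.End ℝ (X → ℝ)} {cf : ι → X → ℝ}
          {κ : Type} (DK : Finset κ) {N : κ → Module.End ℝ (X → ℝ)} {z : κ → X → ℝ},
          mulOp hI * Ml - Ml * mulOp hI =
            (∑ e ∈ DE, mulOp (cf e) * E e - mulOp c₀) + ∑ k ∈ DK, mulOp (z k) * (N k * mulOp hI - mulOp hI * N k) →
          LocalMajorant blk Gl S (fun y y' => CG * (geomTB D).len y ^ 2 * Real.exp (-(δ * (geomTB D).dist y y'))) →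
          OutLoc blk Gl S →
          (∀ e ∈ DE, LocalMajorant blk (E e * Gl) S (fun y y' => C₁ * (geomTB D).len y * Real.exp (-(δ * (geomTB D).dist y y')))) →
          (∀ e ∈ DE, ∀ x, |cf e x| ≤ s₁ / ((geomTB D).M * (geomTB D).len (blk x))) → (∀ e ∈ DE, ∀ x, cf e x ≠ 0 → blk x ∈ S) →
          (∀ x, |c₀ x| ≤ s₂ / ((geomTB D).M * (geomTB D).len (blk x) ^ 2)) → (∀ x, c₀ x ≠ 0 → blk x ∈ S) →
          (∀ x, |hI x| ≤ 1) → (∀ x, hI x ≠ 0 → blk x ∈ S) →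
          (∀ x x', |hI x' - hI x| ≤ s / (geomTB D).M * ((geomTB D).dist (blk x) (blk x') + r₀)) →
          (∀ k ∈ DK, HasMajorant blk (N k) (fun y y'' => CN / (geomTB D).len y ^ 2 * Real.exp (-(δ * (geomTB D).dist y y'')))) →
          (∀ k ∈ DK, ∀ x, |z k x| ≤ 1) →
          HasMajorant blk Pl (fun y y'' => CN / (geomTB D).len y ^ 2 * Real.exp (-(δ * (geomTB D).dist y y''))) →
          (∀ x, |ζ x| ≤ 1) →
          HasMajorant blk (mulOp ζ * (Dg - Pl) * mulOp hI)
            (fun y y'' => CD * Real.exp (-(cD * (geomTB D).M)) / (geomTB D).len y ^ 2 * Real.exp (-(δ * (geomTB D).dist y y''))) →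
          HasMajorant blk ((kDiag Dg (mulOp hI) (mulOp ζ) Ml Pl * Gl) * mulOp hI)
            (fun y y' =>
              ((DE.card * (s₁ * C₁) + s₂ * CG) / (geomTB D).M +
                    (DK.card + 1) * (s / (geomTB D).M * (CN * CG * (geomTB D).L ^ 2 * (8 / δ + r₀)) * c ^ 2) +
                  CD * Real.exp (-(cD * (geomTB D).M)) * CG * (geomTB D).L ^ 2 * c ^ 2) *
                Real.exp (-(1 / 2 * δ * (geomTB D).dist y y'))) := by
  obtain ⟨M₀, c, hM₀, hc, hall⟩ := ineq2134_diag_torus d ℓ hδ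
  refine ⟨M₀, c, hM₀, hc, ?_⟩
  intro Mh k R P D hMh hP hR hM X blk Dg CG C₁ CN CD cD s s₁ s₂ r₀ hCG hC₁ hCN hCD hs hs₁ hs₂ hr₀ Gl Ml Pl hI c₀ ζ S ι DE E cf κ DK N z hdec hG hGout hEG hcf
    hcfS hc₀ hc₀S hI1 hIS hLip hN hz hPl hζ hD
  have key := hall D hMh hP hR hM blk hCG hC₁ hCN hCD hs hs₁ hs₂ hr₀ (Gl := Gl) (Pl := Pl) (D₃ := mulOp ζ * (Dg - Pl) * mulOp hI) (ζ := ζ)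
    DE DK hG hGout hEG hcf hcfS hc₀ hc₀S hI1 hIS hLip hN hz hPl hζ hD
  -- `kDiag` = line 1 + (line 2 + line 4) + line 3, by `hdec`
  have e : kDiag Dg (mulOp hI) (mulOp ζ) Ml Pl =
      ((∑ e ∈ DE, mulOp (cf e) * E e - mulOp c₀) +
          ((∑ k ∈ DK, mulOp (z k) * (N k * mulOp hI - mulOp hI * N k)) + mulOp ζ * (Pl * mulOp hI - mulOp hI * Pl))) +
        mulOp ζ * (Dg - Pl) * mulOp hI := by
    unfold kDiag
    rw [hdec]
    abel
  rw [e]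
  exact key

/-- **(2.134) FOR `K_{□,□}G_□h_□`, THE `O(M⁻¹)` PACKAGED: `θ₀ = Θ·U/M`.**  For every rate `δ > 0` there are `M₀ > 0` and `Θ ≥ 0` (on `d, L, δ` only) such that
for every member with `L·M_h ≥ M₀`, all constants `C_G, C₁, C_N, C_D, s, s₁, s₂, r₀ ≥ 0`, `c_D > 0` and all data as in `ineq2134_kDiag_torus` (print's `G_□` with
ITS OWN two-scale `P_□ =: Pl`, p. 239, (2.88)-shape majorant; line 3 `ζ_□(∂P∂* − ∂P_□∂*)h_□` with the change-of-domain majorant `C_De^{−c_DM}(L^jη)^{−2}e^{−δd}`,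
p. 238): `HasMajorant blk ((K_{□,□}·G_□)·h_□) (θ₀·e^{−(δ/2)d(y,y′)})` with **`θ₀ = Θ·U/M`**, `M = L·M_h`,
`U = #E·s₁C₁ + s₂C_G + (#K+1)·s·((C_N+1)C_G(1+r₀)) + C_DC_G/c_D` — the printed `O(M⁻¹)`, every factor located; literally the hypothesis `h2134` of
`…B6Prop26Gluing.majorant_R_of_2134` / `prop26_2136_of_2133_2134(_lemma21)` for the pair (□, □) (`Kt □ □ = K_{□,□}G_□`), AT THE GIVEN RATE `δ`.
[cite: Balaban1984PropagatorsII, (2.134) p.247; (2.92) p.239; p.238 (remarks)] -/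
theorem ineq2134_kDiag_torus_theta (d ℓ : ℕ) {δ : ℝ} (hδ : 0 < δ) :
    ∃ M₀ Θ : ℝ, 0 < M₀ ∧ 0 ≤ Θ ∧
      ∀ {Mh k R : ℕ} {P : Fin (d + 1) → ℕ} (D : TDomains d ℓ Mh k P R), 1 ≤ Mh → (∀ μ, 1 ≤ P μ) → 2 * (ℓ + 1) ≤ R →
        M₀ ≤ ((ℓ : ℝ) + 1) * Mh → ∀ {X : Type} (blk : X → (geomTB D).Site) (Dg : Module.End ℝ (X → ℝ)),
        ∀ {CG C₁ CN CD cD s s₁ s₂ r₀ : ℝ}, 0 ≤ CG → 0 ≤ C₁ → 0 ≤ CN → 0 ≤ CD → 0 < cD → 0 ≤ s → 0 ≤ s₁ → 0 ≤ s₂ → 0 ≤ r₀ →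
        ∀ {Gl Ml Pl : Module.End ℝ (X → ℝ)} {hI c₀ ζ : X → ℝ} {S : Set (geomTB D).Site}
          {ι : Type} (DE : Finset ι) {E : ι → Module.End ℝ (X → ℝ)} {cf : ι → X → ℝ}
          {κ : Type} (DK : Finset κ) {N : κ → Module.End ℝ (X → ℝ)} {z : κ → X → ℝ},
          mulOp hI * Ml - Ml * mulOp hI =
            (∑ e ∈ DE, mulOp (cf e) * E e - mulOp c₀) + ∑ k ∈ DK, mulOp (z k) * (N k * mulOp hI - mulOp hI * N k) →
          LocalMajorant blk Gl S (fun y y' => CG * (geomTB D).len y ^ 2 * Real.exp (-(δ * (geomTB D).dist y y'))) →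
          OutLoc blk Gl S →
          (∀ e ∈ DE, LocalMajorant blk (E e * Gl) S (fun y y' => C₁ * (geomTB D).len y * Real.exp (-(δ * (geomTB D).dist y y')))) →
          (∀ e ∈ DE, ∀ x, |cf e x| ≤ s₁ / ((geomTB D).M * (geomTB D).len (blk x))) → (∀ e ∈ DE, ∀ x, cf e x ≠ 0 → blk x ∈ S) →
          (∀ x, |c₀ x| ≤ s₂ / ((geomTB D).M * (geomTB D).len (blk x) ^ 2)) → (∀ x, c₀ x ≠ 0 → blk x ∈ S) →
          (∀ x, |hI x| ≤ 1) → (∀ x, hI x ≠ 0 → blk x ∈ S) →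
          (∀ x x', |hI x' - hI x| ≤ s / (geomTB D).M * ((geomTB D).dist (blk x) (blk x') + r₀)) →
          (∀ k ∈ DK, HasMajorant blk (N k) (fun y y'' => CN / (geomTB D).len y ^ 2 * Real.exp (-(δ * (geomTB D).dist y y'')))) →
          (∀ k ∈ DK, ∀ x, |z k x| ≤ 1) →
          HasMajorant blk Pl (fun y y'' => CN / (geomTB D).len y ^ 2 * Real.exp (-(δ * (geomTB D).dist y y''))) →
          (∀ x, |ζ x| ≤ 1) →
          HasMajorant blk (mulOp ζ * (Dg - Pl) * mulOp hI)
            (fun y y'' => CD * Real.exp (-(cD * (geomTB D).M)) / (geomTB D).len y ^ 2 * Real.exp (-(δ * (geomTB D).dist y y''))) →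
          HasMajorant blk ((kDiag Dg (mulOp hI) (mulOp ζ) Ml Pl * Gl) * mulOp hI)
            (fun y y' => Θ * (DE.card * (s₁ * C₁) + s₂ * CG + (DK.card + 1) * s * ((CN + 1) * CG * (1 + r₀)) + CD * CG / cD) *
              ((geomTB D).M)⁻¹ * Real.exp (-(δ / 2 * (geomTB D).dist y y'))) := by
  obtain ⟨M₀, c, hM₀, hc, hall⟩ := ineq2134_kDiag_torus d ℓ hδ
  obtain ⟨Θ, hΘ⟩ : ∃ Θ : ℝ, Θ = ((ℓ : ℝ) + 1) ^ 2 * c ^ 2 * (0 + 1) * (8 / δ + 1) + 1 := ⟨_, rfl⟩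
  have hΘnn : 0 ≤ Θ := by rw [hΘ]; positivity
  refine ⟨M₀, Θ, hM₀, hΘnn, ?_⟩
  intro Mh k R P D hMh hP hR hM X blk Dg CG C₁ CN CD cD s s₁ s₂ r₀ hCG hC₁ hCN hCD hcD hs hs₁ hs₂ hr₀ Gl Ml Pl hI c₀ ζ S ι DE E cf κ DK N z hdec hG hGout hEG hcf
    hcfS hc₀ hc₀S hI1 hIS hLip hN hz hPl hζ hD
  have hMpos : 0 < (geomTB D).M := M_pos_TB D hMh
  have key := hall D hMh hP hR hM blk Dg hCG hC₁ hCN hCD hs hs₁ hs₂ hr₀ DE DK hdec hG hGout hEG hcf hcfS hc₀ hc₀S hI1 hIS hLip hN hz hPl hζ hD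
  refine hasMajorant_mono _ key fun y y' => ?_
  have hθ := theta_pack_le (L := (geomTB D).L) (c := c) (CP := 0) (CN' := CN) DE.card DK.card hMpos hδ le_rfl hCN (le_mul_succ_left hCN le_rfl) hCN hCG hC₁
    hCD hcD hs hs₁ hs₂ hr₀
  rw [geomTB_L] at hθ ⊢
  rw [← hΘ] at hθ
  have h1 : Real.exp (-(1 / 2 * δ * (geomTB D).dist y y')) = Real.exp (-(δ / 2 * (geomTB D).dist y y')) := by ring_nf
  rw [h1]
  exact mul_le_mul_of_nonneg_right hθ (Real.exp_nonneg _)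

end Literature.MathematicalPhysics.QuantumFieldTheory.Balaban1983to89.B6Ineq2134DiagKLevelTorus
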